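import Mathlib.Tactic
import Literature.NumberTheory.Sieve.WelshCubicRoots
import Literature.NumberTheory.Sieve.WelshCubicRootsGenerator
import HarnessLib

/-!
# Welsh 2018, Theorem 2 — proof of the named fact `Welsh2018_thm2`

Sibling proof file of `WelshCubicRoots.lean`; discharges `Welsh2018_thm2` (M. C. Welsh, *Spacing and
a large sieve type inequality for roots of a cubic congruence*, arXiv:1809.05211, Theorem 2, p. 11:
a disc of radius `1/M` on `ℝ²/ℤ²` contains `≪ 1` of the points `(ν/m, ν²/m)`, `ν³ ≡ 2 (mod m)`,
`M < m ≤ 2M`) as `Welsh2018_thm2_holds`, with an explicit (astronomical, unoptimised) absolute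
constant. Everything here is PROVED; no named fact is introduced.

We follow the architecture of the printed proof (§3 parametrisation (10)/(22), §4 approximation
(26), §6 Lemma 3, Lemma 4 and the proof of Theorem 2) but make it ELEMENTARY: no number field, no
ideal, no unit, no fundamental domain appears — only the integer lattice
`L_{m,ν} = {(x, y, z) ∈ ℤ³ : m ∣ x + yν + zν²}` of a root `ν` of `X³ ≡ 2 (mod m)` (the primitive
ideal of Lemma 1 of the source in the basis `1, 2^{1/3}, 2^{2/3}`) and the norm form
`N(x, y, z) = x³ + 2y³ + 4z³ - 6xyz` ((12), (19) of the source).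

## Part I — the norm form on `L_{m,ν}` (namespace `Welsh2018`)

* From `WelshCubicRootsGenerator.lean` we use `dvd_normForm` (`m ∣ N(v)` for `v ∈ L_{m,ν}`) and
  `normForm_ne_zero` (`N(v) = 0` only for `v = 0`); `dvd_rotate` — `L_{m,ν}` is stable under
  multiplication by `2^{1/3}`, `(x,y,z) ↦ (2z,x,y)`.
* `abs_normForm_le_of_bounds` — the trivial upper bound; with the above (`le_abs_normForm`):
  every non-zero `v ∈ L_{m,ν}` has `m ≤ |N(v)| ≪ ‖v‖³`. This "no short vectors" statement
  REPLACES the fundamental-domain argument of §5 of the source (and the generator / class-number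
  input of §3, which Theorem 2 does not need): it is all that the spacing argument uses.
* `exists_short_vector` (pigeonhole) and `exists_good_vector`: for `M < m ≤ 2M` and
  `R³ ≤ 2M < (R+1)³` there is `(x, y, z) ∈ L_{m,ν}` with `|x|, |y| ≤ 2R`, `|z| ≤ R` and
  `5R |y² - xz| ≥ m` — the row `(a, b, c)` of the source's matrix (10) together with the
  "angle" condition `b² - ac ≍ m^{2/3}` of §4, obtained here from `N = xA₁ + 2zA₂ + 2yA₃`
  (`Aᵢ` the `2 × 2` minors) and a rotation by `2^{1/3}`.

## Part II — approximants, spacing, coding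

* `approx` (= (25)–(26) of the source for the rows `(x,y,z)`, `(2z,x,y)`): ONE approximant
  `Q = (r/Δ, s/Δ)`, `Δ = y² - xz`, within `80/M` of `(ν/m, ν²/m)` (shifted into the disc), with
  the two relations `yQ₁ + zQ₂, xQ₁ + yQ₂ ∈ ℤ`.
* `no_short_relation` (Lemma 4 of the source, deduced directly from `le_abs_normForm` and the
  proximity of `Q`): every non-zero `(A, B) ∈ ℤ²` with `AQ₁ + BQ₂ ∈ ℤ` has `1000·max(|A|,|B|) > R`.
* `dichotomy` (Lemma 3 of the source with the explicit line `(A, B) = (Δs' - sΔ', rΔ' - Δr')`):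
  two approximants within `1/(72000 M)` of each other coincide.
* `Welsh2018_thm2_holds`: the recovery of `(m, ν)` from its approximants (proof of Theorem 2 in
  the source, which uses three approximants) is replaced by an explicit injective CODE of
  bounded range: the cell of `Q` at scale `1/(72000M)`, the cells of `x, y, z` at scale `R/1000`
  (relations of `Q` are `R/1000`-separated, `eq_of_rel_of_floor_eq`), the bounded quotient
  `N(x,y,z)/m ∈ [-103, 103]` (`quotient_bounds`, it determines `m`), and the position of `ν/m`
  inside the disc (`eq_of_tcode_eq`). The number of pairs is at most the cardinality of a fixed
  box in `ℤ⁷`.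
-/

namespace Literature.NumberTheory.Sieve

namespace Welsh2018

/-! ### Part I: the norm form of `ℤ[2^{1/3}]` on the lattices `L_{m,ν}` -/

/-- `L_{m,ν}` is stable under multiplication by `2^{1/3}`: if `m ∣ x + yν + zν²` then
`m ∣ 2z + xν + yν²` and `m ∣ 2y + 2zν + xν²` (the rows `2^{1/3}α`, `2^{2/3}α` of (10) of the
source). [cite: Welsh2018CubicCongruenceSpacing, §3 (10)] -/
theorem dvd_rotate {m ν x y z : ℤ} (hν : m ∣ ν ^ 3 - 2) (h : m ∣ x + y * ν + z * ν ^ 2) :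
    m ∣ 2 * z + x * ν + y * ν ^ 2 ∧ m ∣ 2 * y + 2 * z * ν + x * ν ^ 2 := by
  constructor
  · have e : 2 * z + x * ν + y * ν ^ 2 = ν * (x + y * ν + z * ν ^ 2) - z * (ν ^ 3 - 2) := by ring
    rw [e]
    exact dvd_sub (dvd_mul_of_dvd_right h _) (dvd_mul_of_dvd_right hν _)
  · have e : 2 * y + 2 * z * ν + x * ν ^ 2 =
        ν ^ 2 * (x + y * ν + z * ν ^ 2) - (y + z * ν) * (ν ^ 3 - 2) := by ring
    rw [e]
    exact dvd_sub (dvd_mul_of_dvd_right h _) (dvd_mul_of_dvd_right hν _)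

/-- Trivial upper bound for the norm form from bounds on the coordinates. [folklore] -/
theorem abs_normForm_le_of_bounds {x y z a b c : ℤ} (hx : |x| ≤ a) (hy : |y| ≤ b) (hz : |z| ≤ c) :
    |x ^ 3 + 2 * y ^ 3 + 4 * z ^ 3 - 6 * x * y * z| ≤
      a ^ 3 + 2 * b ^ 3 + 4 * c ^ 3 + 6 * a * b * c := by
  have ha : 0 ≤ a := (abs_nonneg x).trans hx
  have hb : 0 ≤ b := (abs_nonneg y).trans hy
  have h1 : |x ^ 3| ≤ a ^ 3 := by rw [abs_pow]; exact pow_le_pow_left₀ (abs_nonneg _) hx 3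
  have h2 : |y ^ 3| ≤ b ^ 3 := by rw [abs_pow]; exact pow_le_pow_left₀ (abs_nonneg _) hy 3
  have h3 : |z ^ 3| ≤ c ^ 3 := by rw [abs_pow]; exact pow_le_pow_left₀ (abs_nonneg _) hz 3
  have h4 : |x * y * z| ≤ a * b * c := by
    rw [abs_mul, abs_mul]
    exact mul_le_mul (mul_le_mul hx hy (abs_nonneg _) ha) hz (abs_nonneg _) (mul_nonneg ha hb)
  calc |x ^ 3 + 2 * y ^ 3 + 4 * z ^ 3 - 6 * x * y * z|
      ≤ |x ^ 3| + |2 * y ^ 3| + |4 * z ^ 3| + |6 * x * y * z| := by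
        refine (abs_sub _ _).trans ?_
        gcongr
        exact abs_add_three _ _ _
    _ = |x ^ 3| + 2 * |y ^ 3| + 4 * |z ^ 3| + 6 * |x * y * z| := by
        simp only [abs_mul, mul_assoc]
        norm_num
    _ ≤ a ^ 3 + 2 * b ^ 3 + 4 * c ^ 3 + 6 * a * b * c := by linarith

/-- **No short vectors in `L_{m,ν}`** (the substitute for §5 of the source): a non-zero
`(x, y, z)` with `m ∣ x + yν + zν²`, `m ∣ ν³ - 2` has `m ≤ |N(x,y,z)|` (so `m ≤ 13‖(x,y,z)‖∞³`),
by `dvd_normForm` and `normForm_ne_zero` of `WelshCubicRootsGenerator.lean`.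
[cite: Welsh2018CubicCongruenceSpacing, §5 (p. 9)] -/
theorem le_abs_normForm {m ν x y z : ℤ} (hν : m ∣ ν ^ 3 - 2)
    (h : m ∣ x + y * ν + z * ν ^ 2) (hne : ¬(x = 0 ∧ y = 0 ∧ z = 0)) :
    m ≤ |x ^ 3 + 2 * y ^ 3 + 4 * z ^ 3 - 6 * x * y * z| :=
  Int.le_of_dvd (abs_pos.mpr (normForm_ne_zero (by tauto))) ((dvd_abs _ _).mpr (dvd_normForm hν h))

/-- Pigeonhole: for `0 < m < (R+1)³` the lattice `L_{m,ν}` (index `m` in `ℤ³`) has a non-zero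
vector in the cube `[-R, R]³`. [folklore] -/
theorem exists_short_vector {m R : ℕ} (ν : ℕ) (hm : 0 < m) (hmR : m < (R + 1) ^ 3) :
    ∃ x y z : ℤ, ¬(x = 0 ∧ y = 0 ∧ z = 0) ∧ |x| ≤ R ∧ |y| ≤ R ∧ |z| ≤ R ∧
      (m : ℤ) ∣ x + y * ν + z * ν ^ 2 := by
  classical
  set s : Finset (ℕ × ℕ × ℕ) :=
    Finset.range (R + 1) ×ˢ Finset.range (R + 1) ×ˢ Finset.range (R + 1) with hs
  have hcard : (Finset.range m).card < s.card := by
    have : s.card = (R + 1) ^ 3 := by simp [hs]; ring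
    rw [Finset.card_range, this]
    exact hmR
  have hf : ∀ v ∈ s, (fun v : ℕ × ℕ × ℕ => (v.1 + v.2.1 * ν + v.2.2 * ν ^ 2) % m) v ∈
      Finset.range m := fun v _ => Finset.mem_range.mpr (Nat.mod_lt _ hm)
  obtain ⟨⟨a, b, c⟩, hv, ⟨a', b', c'⟩, hw, hne, hfeq⟩ :=
    Finset.exists_ne_map_eq_of_card_lt_of_maps_to hcard hf
  simp only [hs, Finset.mem_product, Finset.mem_range] at hv hw
  have hmod : Nat.ModEq m (a' + b' * ν + c' * ν ^ 2) (a + b * ν + c * ν ^ 2) := hfeq.symm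
  have hd := hmod.dvd
  push_cast at hd
  refine ⟨(a : ℤ) - a', (b : ℤ) - b', (c : ℤ) - c', ?_, ?_, ?_, ?_, ?_⟩
  · rintro ⟨h1, h2, h3⟩
    apply hne
    simp only [Prod.mk.injEq]
    omega
  · rw [abs_sub_le_iff]; constructor <;> omega
  · rw [abs_sub_le_iff]; constructor <;> omega
  · rw [abs_sub_le_iff]; constructor <;> omega
  · convert hd using 1
    ring

/-- **The good vector** (rows `(a,b,c)`, `(2c,a,b)` of (10)/(22) of the source with the angle
condition of §4): for `M < m ≤ 2M`, `R³ ≤ 2M < (R+1)³` and a root `ν` of `X³ ≡ 2 (mod m)` there is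
`(x, y, z) ∈ L_{m,ν}` with `|x|, |y| ≤ 2R`, `|z| ≤ R` and `5R·|y² - xz| ≥ m`. Proof: a short
vector `v` (pigeonhole) has `m ≤ |N(v)| = |xA₁ + 2zA₂ + 2yA₃| ≤ 5R max |Aᵢ|` with
`A₁ = x² - 2yz`, `A₂ = 2z² - xy`, `A₃ = y² - xz`; replacing `v` by `2^{1/3}v = (2z,x,y)` or
`2^{2/3}v = (2y,2z,x)` moves the largest minor into the `A₃` slot.
[cite: Welsh2018CubicCongruenceSpacing, §4 (26) and §5 (p. 9)] -/
theorem exists_good_vector {M R m : ℕ} (ν : ℕ) (hMm : M < m) (hm2 : m ≤ 2 * M)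
    (hR' : 2 * M < (R + 1) ^ 3) (hν : (m : ℤ) ∣ (ν : ℤ) ^ 3 - 2) :
    ∃ x y z : ℤ, (m : ℤ) ∣ x + y * ν + z * ν ^ 2 ∧ |x| ≤ 2 * R ∧ |y| ≤ 2 * R ∧ |z| ≤ R ∧
      (m : ℤ) ≤ 5 * R * |y ^ 2 - x * z| := by
  have hm0 : 0 < m := by omega
  obtain ⟨x, y, z, hne, hx, hy, hz, hdvd⟩ :=
    exists_short_vector (R := R) ν hm0 (lt_of_le_of_lt hm2 hR')
  have hR0 : (0 : ℤ) ≤ R := by positivity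
  have hN : (m : ℤ) ≤ |x ^ 3 + 2 * y ^ 3 + 4 * z ^ 3 - 6 * x * y * z| :=
    le_abs_normForm hν hdvd hne
  set A₁ := x ^ 2 - 2 * y * z with hA₁
  set A₂ := 2 * z ^ 2 - x * y with hA₂
  set A₃ := y ^ 2 - x * z with hA₃
  have hdec : x ^ 3 + 2 * y ^ 3 + 4 * z ^ 3 - 6 * x * y * z = x * A₁ + 2 * z * A₂ + 2 * y * A₃ := by
    simp only [hA₁, hA₂, hA₃]; ring
  have hbound : (m : ℤ) ≤ R * (|A₁| + 2 * |A₂| + 2 * |A₃|) := by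
    calc (m : ℤ) ≤ |x ^ 3 + 2 * y ^ 3 + 4 * z ^ 3 - 6 * x * y * z| := hN
      _ = |x * A₁ + 2 * z * A₂ + 2 * y * A₃| := by rw [hdec]
      _ ≤ |x * A₁| + |2 * z * A₂| + |2 * y * A₃| := abs_add_three _ _ _
      _ = |x| * |A₁| + 2 * |z| * |A₂| + 2 * |y| * |A₃| := by
        simp only [abs_mul]
        norm_num
      _ ≤ R * |A₁| + 2 * R * |A₂| + 2 * R * |A₃| := by gcongr
      _ = R * (|A₁| + 2 * |A₂| + 2 * |A₃|) := by ring
  obtain ⟨hrot1, hrot2⟩ := dvd_rotate hν hdvd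
  by_cases h3 : |A₁| ≤ |A₃| ∧ |A₂| ≤ |A₃|
  · refine ⟨x, y, z, hdvd, by linarith, by linarith, hz, ?_⟩
    have : (R : ℤ) * (|A₁| + 2 * |A₂| + 2 * |A₃|) ≤ R * (5 * |A₃|) :=
      mul_le_mul_of_nonneg_left (by linarith [h3.1, h3.2]) hR0
    rw [← hA₃]
    linarith
  by_cases h1 : |A₃| ≤ |A₁| ∧ |A₂| ≤ |A₁|
  · refine ⟨2 * z, x, y, hrot1, ?_, by linarith, hy, ?_⟩
    · rw [abs_mul]
      norm_num
      linarith
    · have e : x ^ 2 - 2 * z * y = A₁ := by rw [hA₁]; ring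
      have : (R : ℤ) * (|A₁| + 2 * |A₂| + 2 * |A₃|) ≤ R * (5 * |A₁|) :=
        mul_le_mul_of_nonneg_left (by linarith [h1.1, h1.2]) hR0
      rw [e]
      linarith
  · have h2 : |A₁| ≤ |A₂| ∧ |A₃| ≤ |A₂| := by
      push Not at h3 h1
      rcases le_total |A₁| |A₃| with h | h
      · have := h3 h
        constructor <;> linarith
      · have := h1 h
        constructor <;> linarith
    refine ⟨2 * y, 2 * z, x, hrot2, ?_, ?_, hx, ?_⟩
    · rw [abs_mul]
      norm_num
      linarith
    · rw [abs_mul]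
      norm_num
      linarith
    · have e : (2 * z) ^ 2 - 2 * y * x = 2 * A₂ := by rw [hA₂]; ring
      have : (R : ℤ) * (|A₁| + 2 * |A₂| + 2 * |A₃|) ≤ R * (5 * |A₂|) :=
        mul_le_mul_of_nonneg_left (by linarith [h2.1, h2.2]) hR0
      rw [e, abs_mul]
      norm_num
      nlinarith [abs_nonneg A₂]

/-- Integer cube root: every `n` lies in `[R³, (R+1)³)` for some `R`. [folklore] -/
theorem exists_cube_le (n : ℕ) : ∃ R : ℕ, R ^ 3 ≤ n ∧ n < (R + 1) ^ 3 := by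
  classical
  have hex : ∃ R : ℕ, n < (R + 1) ^ 3 :=
    ⟨n, lt_of_lt_of_le (Nat.lt_succ_self n) (Nat.le_self_pow (by norm_num) _)⟩
  refine ⟨Nat.find hex, ?_, Nat.find_spec hex⟩
  rcases h : Nat.find hex with _ | k
  · simp
  · have hk := Nat.find_min hex (show k < Nat.find hex by omega)
    push Not at hk
    exact hk

/-! ### Part II: approximants, spacing and the injective code -/

/-- From `TorusClose (1/M)`: the nearest-integer translate is within `1/M` in each coordinate.
[folklore] -/
theorem abs_sub_round_le {M : ℕ} {a b x₀ y₀ : ℝ} (h : TorusClose (1 / M) a b x₀ y₀) :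
    |a - round (a - x₀) - x₀| ≤ 1 / M ∧ |b - round (b - y₀) - y₀| ≤ 1 / M := by
  obtain ⟨p, q, hpq⟩ := h
  have hM : (0 : ℝ) ≤ 1 / M := by positivity
  have hp : |a - x₀ - p| ≤ 1 / M :=
    abs_le_of_sq_le_sq (by nlinarith [sq_nonneg (b - y₀ - q)]) hM
  have hq : |b - y₀ - q| ≤ 1 / M :=
    abs_le_of_sq_le_sq (by nlinarith [sq_nonneg (a - x₀ - p)]) hM
  constructor
  · have e : a - round (a - x₀) - x₀ = (a - x₀) - round (a - x₀) := by ring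
    rw [e]
    exact (round_le (a - x₀) p).trans hp
  · have e : b - round (b - y₀) - y₀ = (b - y₀) - round (b - y₀) := by ring
    rw [e]
    exact (round_le (b - y₀) q).trans hq

/-- **The approximant** ((25)–(26) of the source for the rows `(x,y,z)`, `(2z,x,y)`): with
`x + yν + zν² = m(k₁ + yp + zq)`, `2z + xν + yν² = m(k₂ + xp + yq)` and `Δ = y² - xz`, the point
`Q = ((yk₁ - zk₂)/Δ, (yk₂ - xk₁)/Δ)` satisfies `y Q₁ + z Q₂ = k₁`, `x Q₁ + y Q₂ = k₂` and is within
`8R²/(m|Δ|) ≤ 80/M` of `(ν/m - p, ν²/m - q)` when `|x|,|y| ≤ 2R`, `|z| ≤ R`, `5R|Δ| ≥ m`,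
`M < m ≤ 2M`, `R³ ≤ 2M`. [cite: Welsh2018CubicCongruenceSpacing, §4 (26)] -/
theorem approx {M R m ν : ℕ} {x y z p q k₁ k₂ : ℤ} (hMm : M < m) (hm2 : m ≤ 2 * M)
    (hR : R ^ 3 ≤ 2 * M)
    (hk₁ : x + y * ν + z * ν ^ 2 = m * (k₁ + y * p + z * q))
    (hk₂ : 2 * z + x * ν + y * ν ^ 2 = m * (k₂ + x * p + y * q))
    (hx : |x| ≤ 2 * R) (hy : |y| ≤ 2 * R) (hz : |z| ≤ R)
    (hΔ : (m : ℤ) ≤ 5 * R * |y ^ 2 - x * z|) :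
    |((ν : ℝ) / m - p) - ((y * k₁ - z * k₂ : ℤ) : ℝ) / ((y ^ 2 - x * z : ℤ) : ℝ)| ≤ 80 / M ∧
    |((ν : ℝ) ^ 2 / m - q) - ((y * k₂ - x * k₁ : ℤ) : ℝ) / ((y ^ 2 - x * z : ℤ) : ℝ)| ≤ 80 / M ∧
    (y : ℝ) * (((y * k₁ - z * k₂ : ℤ) : ℝ) / ((y ^ 2 - x * z : ℤ) : ℝ)) +
        z * (((y * k₂ - x * k₁ : ℤ) : ℝ) / ((y ^ 2 - x * z : ℤ) : ℝ)) = k₁ ∧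
    (x : ℝ) * (((y * k₁ - z * k₂ : ℤ) : ℝ) / ((y ^ 2 - x * z : ℤ) : ℝ)) +
        y * (((y * k₂ - x * k₁ : ℤ) : ℝ) / ((y ^ 2 - x * z : ℤ) : ℝ)) = k₂ := by
  have hm0 : 0 < m := by omega
  have hM0 : 0 < M := by omega
  have hΔ0 : y ^ 2 - x * z ≠ 0 := by
    intro h0
    rw [h0] at hΔ
    simp at hΔ
    omega
  have hR0 : 0 < R := by
    rcases Nat.eq_zero_or_pos R with h | h
    · subst h
      simp at hΔ
      omega
    · exact h
  have hmr : (0 : ℝ) < m := by exact_mod_cast hm0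
  have hMr : (0 : ℝ) < M := by exact_mod_cast hM0
  have hΔr : ((y ^ 2 - x * z : ℤ) : ℝ) ≠ 0 := by exact_mod_cast hΔ0
  have hΔr' : (y : ℝ) ^ 2 - x * z ≠ 0 := by exact_mod_cast hΔ0
  have hΔr'' : (y : ℝ) ^ 2 - z * x ≠ 0 := by rw [mul_comm]; exact hΔr'
  have hk₁' : (x : ℝ) + y * ν + z * ν ^ 2 = m * (k₁ + y * p + z * q) := by exact_mod_cast hk₁
  have hk₂' : (2 : ℝ) * z + x * ν + y * ν ^ 2 = m * (k₂ + x * p + y * q) := by exact_mod_cast hk₂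
  -- the integer inequality `8 R² M ≤ 80 m |Δ|`
  have hkey : (8 : ℤ) * R ^ 2 * M ≤ 80 * (m * |y ^ 2 - x * z|) := by
    have h1 : (8 : ℤ) * R ^ 3 * M ≤ 16 * M ^ 2 := by
      have : (R : ℤ) ^ 3 ≤ 2 * M := by exact_mod_cast hR
      nlinarith
    have h2 : (16 : ℤ) * M ^ 2 ≤ 16 * m ^ 2 := by
      have : (M : ℤ) ≤ m := by exact_mod_cast hMm.le
      nlinarith
    have h3 : (16 : ℤ) * m ^ 2 ≤ 80 * R * (m * |y ^ 2 - x * z|) := by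
      have : (0 : ℤ) ≤ m := by positivity
      nlinarith [hΔ]
    have h4 : (R : ℤ) * (8 * R ^ 2 * M) ≤ R * (80 * (m * |y ^ 2 - x * z|)) := by nlinarith
    exact le_of_mul_le_mul_left h4 (by exact_mod_cast hR0)
  have hkeyr : (8 : ℝ) * R ^ 2 * M ≤ 80 * (m * |(y : ℝ) ^ 2 - x * z|) := by
    have : ((8 * R ^ 2 * M : ℤ) : ℝ) ≤ ((80 * (m * |y ^ 2 - x * z|) : ℤ) : ℝ) := by
      exact_mod_cast hkey
    push_cast at this
    exact this
  have hRM : (0 : ℝ) ≤ R ^ 2 * M := by positivity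
  refine ⟨?_, ?_, ?_, ?_⟩
  · have e : ((ν : ℝ) / m - p) - ((y * k₁ - z * k₂ : ℤ) : ℝ) / ((y ^ 2 - x * z : ℤ) : ℝ) =
        -((x : ℝ) * y - 2 * z ^ 2) / (m * ((y : ℝ) ^ 2 - x * z)) := by
      push_cast
      field_simp
      linear_combination (y : ℝ) * hk₁' - (z : ℝ) * hk₂'
    rw [e, abs_div, abs_neg, abs_mul, Nat.abs_cast, div_le_div_iff₀ (by positivity) hMr]
    have hb : |(x : ℝ) * y - 2 * z ^ 2| ≤ (6 * R ^ 2 : ℝ) := by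
      have : |x * y - 2 * z ^ 2| ≤ (6 * R ^ 2 : ℤ) := by
        calc |x * y - 2 * z ^ 2| ≤ |x * y| + |2 * z ^ 2| := abs_sub _ _
          _ = |x| * |y| + 2 * |z| ^ 2 := by simp [abs_mul, abs_pow]
          _ ≤ 2 * R * (2 * R) + 2 * R ^ 2 := by gcongr
          _ = 6 * R ^ 2 := by ring
      have h' : ((|x * y - 2 * z ^ 2| : ℤ) : ℝ) ≤ ((6 * R ^ 2 : ℤ) : ℝ) := by exact_mod_cast this
      push_cast at h'
      exact h'
    calc |(x : ℝ) * y - 2 * z ^ 2| * (M : ℝ) ≤ (6 * R ^ 2 : ℝ) * M := by gcongr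
      _ ≤ 80 * (m * |(y : ℝ) ^ 2 - x * z|) := by nlinarith [hkeyr, hRM]
  · have e : ((ν : ℝ) ^ 2 / m - q) - ((y * k₂ - x * k₁ : ℤ) : ℝ) / ((y ^ 2 - x * z : ℤ) : ℝ) =
        -((2 : ℝ) * y * z - x ^ 2) / (m * ((y : ℝ) ^ 2 - x * z)) := by
      push_cast
      field_simp
      linear_combination (-(x : ℝ)) * hk₁' + (y : ℝ) * hk₂'
    rw [e, abs_div, abs_neg, abs_mul, Nat.abs_cast, div_le_div_iff₀ (by positivity) hMr]
    have hb : |(2 : ℝ) * y * z - x ^ 2| ≤ (8 * R ^ 2 : ℝ) := by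
      have : |2 * y * z - x ^ 2| ≤ (8 * R ^ 2 : ℤ) := by
        calc |2 * y * z - x ^ 2| ≤ |2 * y * z| + |x ^ 2| := abs_sub _ _
          _ = 2 * |y| * |z| + |x| ^ 2 := by simp [abs_mul, abs_pow]
          _ ≤ 2 * (2 * R) * R + (2 * R) ^ 2 := by gcongr
          _ = 8 * R ^ 2 := by ring
      have h' : ((|2 * y * z - x ^ 2| : ℤ) : ℝ) ≤ ((8 * R ^ 2 : ℤ) : ℝ) := by exact_mod_cast this
      push_cast at h'
      exact h'
    calc |(2 : ℝ) * y * z - x ^ 2| * (M : ℝ) ≤ (8 * R ^ 2 : ℝ) * M := by gcongr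
      _ ≤ 80 * (m * |(y : ℝ) ^ 2 - x * z|) := hkeyr
  · push_cast
    field_simp
    ring
  · push_cast
    field_simp
    ring

/-- **No short relations at an approximant** (Lemma 4 of the source, here from `le_abs_norm`):
if `Q = (Q₁, Q₂)` is within `80/M` of `(ν/m - p, ν²/m - q)` for a root `ν (mod m)`,
`M < m ≤ 2M`, `R³ ≤ 2M`, then every non-zero `(A, B) ∈ ℤ²` with `A Q₁ + B Q₂ ∈ ℤ` has
`1000 · max(|A|, |B|) > R`: otherwise `(-X, A, B) ∈ L_{m,ν}` with `|X| ≤ 320 max(|A|,|B|)` would be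
a short vector. [cite: Welsh2018CubicCongruenceSpacing, Lemma 4 (p. 11)] -/
theorem no_short_relation {M R m ν : ℕ} {p q A B n : ℤ} {Q₁ Q₂ : ℝ} (hMm : M < m)
    (hm2 : m ≤ 2 * M) (hR : R ^ 3 ≤ 2 * M) (hν : (m : ℤ) ∣ (ν : ℤ) ^ 3 - 2)
    (h₁ : |((ν : ℝ) / m - p) - Q₁| ≤ 80 / M) (h₂ : |((ν : ℝ) ^ 2 / m - q) - Q₂| ≤ 80 / M)
    (hrel : (A : ℝ) * Q₁ + B * Q₂ = n) (hAB : ¬(A = 0 ∧ B = 0)) :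
    (R : ℤ) < 1000 * max |A| |B| := by
  have hm0 : 0 < m := by omega
  have hM0 : 0 < M := by omega
  have hmr : (0 : ℝ) < m := by exact_mod_cast hm0
  have hMr : (0 : ℝ) < M := by exact_mod_cast hM0
  set μ : ℤ := max |A| |B| with hμ
  have hμA : |A| ≤ μ := le_max_left _ _
  have hμB : |B| ≤ μ := le_max_right _ _
  have hμ1 : 1 ≤ μ := by
    rcases not_and_or.mp hAB with h | h
    · exact (Int.one_le_abs h).trans hμA
    · exact (Int.one_le_abs h).trans hμB
  set X : ℤ := A * ν + B * ν ^ 2 - m * (n + A * p + B * q) with hX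
  have hXr : (X : ℝ) = m * (A * (((ν : ℝ) / m - p) - Q₁) + B * (((ν : ℝ) ^ 2 / m - q) - Q₂)) := by
    have e : (A : ℝ) * (((ν : ℝ) / m - p) - Q₁) + B * (((ν : ℝ) ^ 2 / m - q) - Q₂) =
        A * ((ν : ℝ) / m - p) + B * ((ν : ℝ) ^ 2 / m - q) - n := by
      rw [← hrel]
      ring
    rw [e, hX]
    push_cast
    field_simp
    ring
  have hXabs : |(X : ℝ)| ≤ 320 * μ := by
    have hA' : |(A : ℝ)| ≤ μ := by exact_mod_cast hμA
    have hB' : |(B : ℝ)| ≤ μ := by exact_mod_cast hμB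
    have hmM : (m : ℝ) ≤ 2 * M := by exact_mod_cast hm2
    rw [hXr, abs_mul, Nat.abs_cast]
    calc (m : ℝ) * |A * (((ν : ℝ) / m - p) - Q₁) + B * (((ν : ℝ) ^ 2 / m - q) - Q₂)|
        ≤ (2 * M) * (μ * (80 / M) + μ * (80 / M)) := by
          gcongr
          refine (abs_add_le _ _).trans (add_le_add ?_ ?_)
          · rw [abs_mul]
            exact mul_le_mul hA' h₁ (abs_nonneg _) (by positivity)
          · rw [abs_mul]
            exact mul_le_mul hB' h₂ (abs_nonneg _) (by positivity)
      _ = 320 * μ := by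
          have hMM : (M : ℝ) / M = 1 := div_self hMr.ne'
          linear_combination (320 * (μ : ℝ)) * hMM
  have hXabs' : |X| ≤ 320 * μ := by exact_mod_cast hXabs
  have hdvd : (m : ℤ) ∣ (-X) + A * ν + B * ν ^ 2 := ⟨n + A * p + B * q, by rw [hX]; ring⟩
  have hne : ¬(-X = 0 ∧ A = 0 ∧ B = 0) := fun h => hAB ⟨h.2.1, h.2.2⟩
  have hKL := le_abs_normForm hν hdvd hne
  have hNle :=
    abs_normForm_le_of_bounds (x := -X) (a := 320 * μ) (by rw [abs_neg]; exact hXabs') hμA hμB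
  have h3 : (R : ℤ) ^ 3 < (1000 * μ) ^ 3 := by
    have hR' : (R : ℤ) ^ 3 ≤ 2 * M := by exact_mod_cast hR
    have hMm' : (M : ℤ) < m := by exact_mod_cast hMm
    have hμ3 : 0 < μ ^ 3 := by positivity
    nlinarith [hKL, hNle]
  exact lt_of_pow_lt_pow_left₀ 3 (by positivity) h3

/-- Bookkeeping for a good vector: `e = N(x,y,z)/m` is an integer with `1 ≤ |e| ≤ 103`
(`|N| ≤ 52R³ ≤ 104M < 104m`), and `0 < |y² - xz| ≤ 6R²`. [folklore] -/
theorem quotient_bounds {M R m ν : ℕ} {x y z : ℤ} (hMm : M < m) (hR : R ^ 3 ≤ 2 * M)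
    (hν : (m : ℤ) ∣ (ν : ℤ) ^ 3 - 2)
    (hdvd : (m : ℤ) ∣ x + y * ν + z * ν ^ 2)
    (hx : |x| ≤ 2 * R) (hy : |y| ≤ 2 * R) (hz : |z| ≤ R)
    (hΔ : (m : ℤ) ≤ 5 * R * |y ^ 2 - x * z|) :
    (m : ℤ) * ((x ^ 3 + 2 * y ^ 3 + 4 * z ^ 3 - 6 * x * y * z) / m) =
        x ^ 3 + 2 * y ^ 3 + 4 * z ^ 3 - 6 * x * y * z ∧
      (x ^ 3 + 2 * y ^ 3 + 4 * z ^ 3 - 6 * x * y * z) / m ≠ 0 ∧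
      |(x ^ 3 + 2 * y ^ 3 + 4 * z ^ 3 - 6 * x * y * z) / m| ≤ 103 ∧
      y ^ 2 - x * z ≠ 0 ∧ |y ^ 2 - x * z| ≤ 6 * R ^ 2 := by
  have hm0 : 0 < m := by omega
  set N := x ^ 3 + 2 * y ^ 3 + 4 * z ^ 3 - 6 * x * y * z with hN
  have hmN : (m : ℤ) ∣ N := by rw [hN]; exact dvd_normForm hν hdvd
  have hmul : (m : ℤ) * (N / m) = N := Int.mul_ediv_cancel' hmN
  have hΔ0 : y ^ 2 - x * z ≠ 0 := by
    intro h0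
    rw [h0] at hΔ
    simp at hΔ
    omega
  have hne : ¬(x = 0 ∧ y = 0 ∧ z = 0) := by
    rintro ⟨rfl, rfl, rfl⟩
    simp at hΔ0
  have hN0 : N ≠ 0 := by rw [hN]; exact normForm_ne_zero (by tauto)
  have hR0 : (0 : ℤ) ≤ R := by positivity
  have hNle : |N| ≤ 52 * R ^ 3 := by
    have h := abs_normForm_le_of_bounds hx hy hz
    have e : (2 * R : ℤ) ^ 3 + 2 * (2 * R) ^ 3 + 4 * R ^ 3 + 6 * (2 * R) * (2 * R) * R =
        52 * R ^ 3 := by ring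
    rw [e] at h
    exact h
  refine ⟨hmul, ?_, ?_, hΔ0, ?_⟩
  · intro h0
    rw [h0, mul_zero] at hmul
    exact hN0 hmul.symm
  · have h1 : (m : ℤ) * |N / m| < m * 104 := by
      calc (m : ℤ) * |N / m| = |N| := by
            conv_rhs => rw [← hmul]
            rw [abs_mul, Nat.abs_cast]
        _ ≤ 52 * R ^ 3 := hNle
        _ ≤ 52 * (2 * M) := by gcongr; exact_mod_cast hR
        _ < m * 104 := by
            have : (M : ℤ) < m := by exact_mod_cast hMm
            linarith
    have h2 : |N / m| < 104 := lt_of_mul_lt_mul_left h1 (by positivity)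
    omega
  · calc |y ^ 2 - x * z| ≤ |y ^ 2| + |x * z| := abs_sub _ _
      _ = |y| ^ 2 + |x| * |z| := by rw [abs_pow, abs_mul]
      _ ≤ (2 * R) ^ 2 + 2 * R * R := by gcongr
      _ = 6 * R ^ 2 := by ring

/-- Equal integer parts at scale `K` force distance `< 1/K`. [folklore] -/
theorem abs_sub_lt_of_floor_mul_eq {u v K : ℝ} (hK : 0 < K) (h : ⌊u * K⌋ = ⌊v * K⌋) :
    |u - v| < 1 / K := by
  have h1 := Int.abs_sub_lt_one_of_floor_eq_floor h
  rw [← sub_mul, abs_mul, abs_of_pos hK] at h1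
  rw [lt_div_iff₀ hK]
  exact h1

/-- A real number with explicit bounds has its integer part in the corresponding `Finset.Icc`.
[folklore] -/
theorem floor_mem_Icc {a : ℝ} {lo hi : ℤ} (h1 : (lo : ℝ) ≤ a) (h2 : a < hi + 1) :
    ⌊a⌋ ∈ Finset.Icc lo hi := by
  refine Finset.mem_Icc.mpr ⟨Int.le_floor.mpr h1, ?_⟩
  have : ⌊a⌋ < hi + 1 := Int.floor_lt.mpr (by exact_mod_cast h2)
  omega

/-- **Dichotomy for approximants** (Lemma 3 of the source, made explicit): two approximants
`(r/Δ, s/Δ)`, `(r'/Δ', s'/Δ')` with `|Δ|, |Δ'| ≤ 6R²`, no relation of sup-norm `≤ R/1000` at the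
first, and within `1/(72000 M)` of each other in both coordinates, coincide: the integer vector
`(A, B) = (Δs' - sΔ', rΔ' - Δr')` is a relation of `(r/Δ, s/Δ)` of size
`≤ 36R⁴ · dist < R/1000`, hence zero. [cite: Welsh2018CubicCongruenceSpacing, Lemma 3 (p. 10)] -/
theorem dichotomy {R M : ℕ} (hR0 : 0 < R) (hR : R ^ 3 ≤ 2 * M) (hM : 0 < M)
    {r s Δ r' s' Δ' : ℤ} (hΔ : Δ ≠ 0) (hΔ' : Δ' ≠ 0) (h6 : |Δ| ≤ 6 * R ^ 2)
    (h6' : |Δ'| ≤ 6 * R ^ 2) {Q₁ Q₂ Q₁' Q₂' : ℝ} (e₁ : Q₁ = (r : ℝ) / Δ) (e₂ : Q₂ = (s : ℝ) / Δ)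
    (e₁' : Q₁' = (r' : ℝ) / Δ') (e₂' : Q₂' = (s' : ℝ) / Δ')
    (hns : ∀ A B n : ℤ, (A : ℝ) * Q₁ + B * Q₂ = n → ¬(A = 0 ∧ B = 0) →
      (R : ℤ) < 1000 * max |A| |B|)
    (h1 : |Q₁ - Q₁'| < 1 / (72000 * M)) (h2 : |Q₂ - Q₂'| < 1 / (72000 * M)) :
    Q₁ = Q₁' ∧ Q₂ = Q₂' := by
  subst e₁ e₂ e₁' e₂'
  have hRr : (0 : ℝ) < R := by exact_mod_cast hR0
  have hMr : (0 : ℝ) < M := by exact_mod_cast hM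
  have hΔr : (Δ : ℝ) ≠ 0 := by exact_mod_cast hΔ
  have hΔr' : (Δ' : ℝ) ≠ 0 := by exact_mod_cast hΔ'
  have hkey : (6 * R ^ 2 : ℝ) * (6 * R ^ 2) * (1 / (72000 * M)) ≤ R / 1000 := by
    rw [mul_one_div, div_le_div_iff₀ (by positivity) (by positivity)]
    have : (R : ℝ) ^ 3 ≤ 2 * M := by exact_mod_cast hR
    nlinarith [this, hRr]
  have bnd : ∀ (T : ℤ) (d : ℝ), (T : ℝ) = Δ * Δ' * d → |d| < 1 / (72000 * M) →
      1000 * |T| < (R : ℤ) := by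
    intro T d hT hd
    have hΔa : |(Δ : ℝ)| ≤ 6 * R ^ 2 := by exact_mod_cast h6
    have hΔa' : |(Δ' : ℝ)| ≤ 6 * R ^ 2 := by exact_mod_cast h6'
    have hlt : |(T : ℝ)| < R / 1000 := by
      rw [hT, abs_mul, abs_mul]
      calc |(Δ : ℝ)| * |(Δ' : ℝ)| * |d| ≤ (6 * R ^ 2) * (6 * R ^ 2) * |d| := by gcongr
        _ < (6 * R ^ 2) * (6 * R ^ 2) * (1 / (72000 * M)) := by gcongr
        _ ≤ R / 1000 := hkey
    rw [lt_div_iff₀ (by norm_num)] at hlt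
    have hlt' : (1000 : ℝ) * |(T : ℝ)| < R := by linarith
    exact_mod_cast hlt'
  set A : ℤ := Δ * s' - s * Δ' with hA
  set B : ℤ := r * Δ' - Δ * r' with hB
  have hAbnd : 1000 * |A| < (R : ℤ) := by
    refine bnd A ((s' : ℝ) / Δ' - s / Δ) ?_ ?_
    · rw [hA]
      push_cast
      field_simp
    · rw [abs_sub_comm]
      exact h2
  have hBbnd : 1000 * |B| < (R : ℤ) := by
    refine bnd B ((r : ℝ) / Δ - r' / Δ') ?_ h1
    rw [hB]
    push_cast
    field_simp
  by_contra hne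
  have hAB : ¬(A = 0 ∧ B = 0) := by
    rintro ⟨hA0, hB0⟩
    apply hne
    constructor
    · rw [div_eq_div_iff hΔr hΔr']
      have : r * Δ' = r' * Δ := by rw [hB] at hB0; linarith
      exact_mod_cast this
    · rw [div_eq_div_iff hΔr hΔr']
      have : s * Δ' = s' * Δ := by rw [hA] at hA0; linarith
      exact_mod_cast this
  have hrel : (A : ℝ) * ((r : ℝ) / Δ) + B * ((s : ℝ) / Δ) = ((s' * r - r' * s : ℤ) : ℝ) := by
    rw [hA, hB]
    push_cast
    field_simp
    ring
  have h3 := hns A B _ hrel hAB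
  have h4 : 1000 * max |A| |B| < (R : ℤ) := by
    rcases max_cases |A| |B| with ⟨e, _⟩ | ⟨e, _⟩ <;> rw [e] <;> assumption
  linarith

/-- Two relations `(a,b)`, `(a',b')` of a point with no short relations, lying in the same cells
of side `R/1000`, are equal. [folklore] -/
theorem eq_of_rel_of_floor_eq {R : ℕ} (hR : 0 < R) {Q₁ Q₂ : ℝ}
    (hns : ∀ A B n : ℤ, (A : ℝ) * Q₁ + B * Q₂ = n → ¬(A = 0 ∧ B = 0) →
      (R : ℤ) < 1000 * max |A| |B|)
    {a b a' b' n n' : ℤ} (h : (a : ℝ) * Q₁ + b * Q₂ = n) (h' : (a' : ℝ) * Q₁ + b' * Q₂ = n')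
    (ha : ⌊(1000 * a : ℝ) / R⌋ = ⌊(1000 * a' : ℝ) / R⌋)
    (hb : ⌊(1000 * b : ℝ) / R⌋ = ⌊(1000 * b' : ℝ) / R⌋) : a = a' ∧ b = b' := by
  have hRr : (0 : ℝ) < R := by exact_mod_cast hR
  have bound : ∀ c c' : ℤ, ⌊(1000 * c : ℝ) / R⌋ = ⌊(1000 * c' : ℝ) / R⌋ →
      1000 * |c - c'| < (R : ℤ) := by
    intro c c' hc
    have h1 := Int.abs_sub_lt_one_of_floor_eq_floor hc
    rw [← sub_div, abs_div, abs_of_pos hRr, div_lt_one hRr, ← mul_sub, abs_mul] at h1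
    have h2 : (1000 : ℝ) * |(c : ℝ) - c'| < R := by simpa using h1
    exact_mod_cast h2
  by_contra hne
  have hrel : ((a - a' : ℤ) : ℝ) * Q₁ + ((b - b' : ℤ) : ℝ) * Q₂ = ((n - n' : ℤ) : ℝ) := by
    push_cast
    linear_combination h - h'
  have hAB : ¬(a - a' = 0 ∧ b - b' = 0) := fun hh => hne ⟨by omega, by omega⟩
  have h1 := hns _ _ _ hrel hAB
  have h2 := bound a a' ha
  have h3 := bound b b' hb
  have h4 : 1000 * max |a - a'| |b - b'| < (R : ℤ) := by
    rcases max_cases |a - a'| |b - b'| with ⟨e, _⟩ | ⟨e, _⟩ <;> rw [e] <;> assumption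
  linarith

/-- Position code of `ν/m` in the disc: for fixed `m ≤ 2M`, the integer part of
`(ν/m - p - x₀ + 1/M)·2M` determines `ν < m` (differences of the `ν/m - p` are multiples of
`1/m ≥ 1/(2M)`). [folklore] -/
theorem eq_of_tcode_eq {M m ν ν' : ℕ} {p p' : ℤ} {x₀ : ℝ} (hm2 : m ≤ 2 * M) (hm0 : 0 < m)
    (hν : ν < m) (hν' : ν' < m)
    (h : ⌊((ν : ℝ) / m - p - x₀ + 1 / M) * (2 * M)⌋ =
      ⌊((ν' : ℝ) / m - p' - x₀ + 1 / M) * (2 * M)⌋) : ν = ν' := by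
  have hM0 : 0 < M := by omega
  have hMr : (0 : ℝ) < 2 * M := by positivity
  have hmr : (0 : ℝ) < m := by exact_mod_cast hm0
  have h1 := abs_sub_lt_of_floor_mul_eq hMr h
  have e : ((ν : ℝ) / m - p - x₀ + 1 / M) - ((ν' : ℝ) / m - p' - x₀ + 1 / M) =
      ((ν - ν' - m * (p - p') : ℤ) : ℝ) / m := by
    push_cast
    field_simp
    ring
  rw [e, abs_div, Nat.abs_cast, div_lt_iff₀ hmr] at h1
  have hI : |((ν - ν' - m * (p - p') : ℤ) : ℝ)| < 1 := by
    refine h1.trans_le ?_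
    rw [div_mul_eq_mul_div, one_mul, div_le_one hMr]
    exact_mod_cast hm2
  have hI0 : (ν : ℤ) - ν' - m * (p - p') = 0 := by
    rw [← Int.abs_lt_one_iff]
    exact_mod_cast hI
  have hdvd : (m : ℤ) ∣ (ν : ℤ) - ν' := ⟨p - p', by linarith⟩
  have habs : |(ν : ℤ) - ν'| < m := by
    rw [abs_lt]
    constructor <;> omega
  have := Int.eq_zero_of_abs_lt_dvd hdvd habs
  omega

end Welsh2018

open Welsh2018

/-- **Welsh 2018, Theorem 2** — discharge of the named fact `Welsh2018_thm2`: an absolute bound for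
the number of pairs `(m, ν)`, `M < m ≤ 2M`, `ν³ ≡ 2 (mod m)`, whose point `(ν/m, ν²/m)` lies in a
disc of radius `1/M` of `ℝ²/ℤ²`. Proof: the injective code described in the module docstring
(good vector → approximant → cells), landing in a fixed finite box of `ℤ⁷`.
[cite: Welsh2018CubicCongruenceSpacing, Thm 2 (p. 11)] -/
theorem Welsh2018_thm2_holds : Welsh2018_thm2 := by
  classical
  obtain ⟨Box, hBox⟩ : ∃ Box : Finset (ℤ × ℤ × ℤ × ℤ × ℤ × ℤ × ℤ), Box =
      Finset.Icc (0 : ℤ) 11664000 ×ˢ Finset.Icc (0 : ℤ) 11664000 ×ˢ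
        Finset.Icc (-2000 : ℤ) 2000 ×ˢ Finset.Icc (-2000 : ℤ) 2000 ×ˢ
        Finset.Icc (-1000 : ℤ) 1000 ×ˢ Finset.Icc (-103 : ℤ) 103 ×ˢ Finset.Icc (0 : ℤ) 4 :=
    ⟨_, rfl⟩
  refine ⟨(Box.card : ℝ), ?_⟩
  intro M hM x₀ y₀
  suffices key : ∀ S : Finset (Σ _ : ℕ, ℕ), (∀ j ∈ S, M < j.1 ∧ j.1 ≤ 2 * M ∧ j.2 < j.1 ∧
      ((j.1 : ℤ) ∣ (j.2 : ℤ) ^ 3 - 2) ∧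
      TorusClose (1 / M) ((j.2 : ℝ) / j.1) ((j.2 : ℝ) ^ 2 / j.1) x₀ y₀) →
      (S.card : ℝ) ≤ Box.card by
    refine key _ ?_
    intro j hj
    simp only [Finset.mem_filter, Finset.mem_sigma, Finset.mem_Ioc, mem_cubicRoots] at hj
    exact ⟨hj.1.1.1, hj.1.1.2, hj.1.2.1, hj.1.2.2, hj.2⟩
  intro S hmem
  have hMpos : 0 < M := hM
  have hMr : (0 : ℝ) < M := by exact_mod_cast hMpos
  have hMne : (M : ℝ) ≠ 0 := hMr.ne'
  obtain ⟨R, hR, hR'⟩ := exists_cube_le (2 * M)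
  have hR0 : 0 < R := by
    rcases Nat.eq_zero_or_pos R with h | h
    · subst h
      simp at hR'
      omega
    · exact h
  have hRr : (0 : ℝ) < R := by exact_mod_cast hR0
  -- a good vector for every pair
  have hgood : ∀ j : (Σ _ : ℕ, ℕ), ∃ x y z : ℤ, j ∈ S →
      ((j.1 : ℤ) ∣ x + y * j.2 + z * j.2 ^ 2 ∧ |x| ≤ 2 * R ∧ |y| ≤ 2 * R ∧ |z| ≤ R ∧
        (j.1 : ℤ) ≤ 5 * R * |y ^ 2 - x * z|) := by
    intro j
    by_cases hj : j ∈ S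
    · obtain ⟨h1, h2, -, h4, -⟩ := hmem j hj
      obtain ⟨x, y, z, h⟩ := exists_good_vector (R := R) j.2 h1 h2 hR' h4
      exact ⟨x, y, z, fun _ => h⟩
    · exact ⟨0, 0, 0, fun h => absurd h hj⟩
  choose X Y Z hV using hgood
  -- the remaining data attached to a pair, as opaque functions with defining equations
  obtain ⟨P, hP⟩ : ∃ P : (Σ _ : ℕ, ℕ) → ℤ, ∀ j, P j = round ((j.2 : ℝ) / j.1 - x₀) :=
    ⟨_, fun _ => rfl⟩
  obtain ⟨Qr, hQr⟩ : ∃ Qr : (Σ _ : ℕ, ℕ) → ℤ, ∀ j, Qr j = round ((j.2 : ℝ) ^ 2 / j.1 - y₀) :=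
    ⟨_, fun _ => rfl⟩
  obtain ⟨K₁, hK₁⟩ : ∃ K₁ : (Σ _ : ℕ, ℕ) → ℤ, ∀ j,
      K₁ j = (X j + Y j * j.2 + Z j * j.2 ^ 2) / j.1 - Y j * P j - Z j * Qr j :=
    ⟨_, fun _ => rfl⟩
  obtain ⟨K₂, hK₂⟩ : ∃ K₂ : (Σ _ : ℕ, ℕ) → ℤ, ∀ j,
      K₂ j = (2 * Z j + X j * j.2 + Y j * j.2 ^ 2) / j.1 - X j * P j - Y j * Qr j :=
    ⟨_, fun _ => rfl⟩
  obtain ⟨Q₁, hQ₁⟩ : ∃ Q₁ : (Σ _ : ℕ, ℕ) → ℝ, ∀ j,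
      Q₁ j = ((Y j * K₁ j - Z j * K₂ j : ℤ) : ℝ) / ((Y j ^ 2 - X j * Z j : ℤ) : ℝ) :=
    ⟨_, fun _ => rfl⟩
  obtain ⟨Q₂, hQ₂⟩ : ∃ Q₂ : (Σ _ : ℕ, ℕ) → ℝ, ∀ j,
      Q₂ j = ((Y j * K₂ j - X j * K₁ j : ℤ) : ℝ) / ((Y j ^ 2 - X j * Z j : ℤ) : ℝ) :=
    ⟨_, fun _ => rfl⟩
  obtain ⟨E, hE⟩ : ∃ E : (Σ _ : ℕ, ℕ) → ℤ, ∀ j,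
      E j = (X j ^ 3 + 2 * Y j ^ 3 + 4 * Z j ^ 3 - 6 * X j * Y j * Z j) / (j.1 : ℤ) :=
    ⟨_, fun _ => rfl⟩
  obtain ⟨Ψ, hΨ⟩ : ∃ Ψ : (Σ _ : ℕ, ℕ) → ℤ × ℤ × ℤ × ℤ × ℤ × ℤ × ℤ, ∀ j,
      Ψ j = (⌊(Q₁ j - x₀ + 81 / M) * (72000 * M)⌋, ⌊(Q₂ j - y₀ + 81 / M) * (72000 * M)⌋,
        ⌊(1000 * X j : ℝ) / R⌋, ⌊(1000 * Y j : ℝ) / R⌋, ⌊(1000 * Z j : ℝ) / R⌋, E j,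
        ⌊((j.2 : ℝ) / j.1 - P j - x₀ + 1 / M) * (2 * M)⌋) :=
    ⟨_, fun _ => rfl⟩
  -- facts about the data
  have hK : ∀ j ∈ S, X j + Y j * j.2 + Z j * j.2 ^ 2 = j.1 * (K₁ j + Y j * P j + Z j * Qr j) ∧
      2 * Z j + X j * j.2 + Y j * j.2 ^ 2 = j.1 * (K₂ j + X j * P j + Y j * Qr j) := by
    intro j hj
    obtain ⟨-, -, -, h4, -⟩ := hmem j hj
    obtain ⟨hdvd, -, -, -, -⟩ := hV j hj
    have hdvd2 := (dvd_rotate h4 hdvd).1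
    constructor
    · rw [hK₁ j]
      have e : (X j + Y j * j.2 + Z j * j.2 ^ 2) / j.1 - Y j * P j - Z j * Qr j + Y j * P j +
          Z j * Qr j = (X j + Y j * j.2 + Z j * j.2 ^ 2) / j.1 := by ring
      rw [e]
      exact (Int.mul_ediv_cancel' hdvd).symm
    · rw [hK₂ j]
      have e : (2 * Z j + X j * j.2 + Y j * j.2 ^ 2) / j.1 - X j * P j - Y j * Qr j + X j * P j +
          Y j * Qr j = (2 * Z j + X j * j.2 + Y j * j.2 ^ 2) / j.1 := by ring
      rw [e]
      exact (Int.mul_ediv_cancel' hdvd2).symm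
  have hF1 : ∀ j ∈ S, |(j.2 : ℝ) / j.1 - P j - x₀| ≤ 1 / M ∧
      |(j.2 : ℝ) ^ 2 / j.1 - Qr j - y₀| ≤ 1 / M := by
    intro j hj
    have h := abs_sub_round_le (hmem j hj).2.2.2.2
    rw [← hP j, ← hQr j] at h
    exact h
  have hF2 : ∀ j ∈ S, |((j.2 : ℝ) / j.1 - P j) - Q₁ j| ≤ 80 / M ∧
      |((j.2 : ℝ) ^ 2 / j.1 - Qr j) - Q₂ j| ≤ 80 / M ∧
      (Y j : ℝ) * Q₁ j + Z j * Q₂ j = K₁ j ∧ (X j : ℝ) * Q₁ j + Y j * Q₂ j = K₂ j := by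
    intro j hj
    obtain ⟨h1, h2, -, -, -⟩ := hmem j hj
    obtain ⟨-, hx, hy, hz, hΔ⟩ := hV j hj
    have h := approx h1 h2 hR (hK j hj).1 (hK j hj).2 hx hy hz hΔ
    rw [← hQ₁ j, ← hQ₂ j] at h
    exact h
  have hF3 : ∀ j ∈ S, (j.1 : ℤ) * E j = X j ^ 3 + 2 * Y j ^ 3 + 4 * Z j ^ 3 - 6 * X j * Y j * Z j ∧
      E j ≠ 0 ∧ |E j| ≤ 103 ∧ Y j ^ 2 - X j * Z j ≠ 0 ∧ |Y j ^ 2 - X j * Z j| ≤ 6 * R ^ 2 := by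
    intro j hj
    obtain ⟨h1, -, -, h4, -⟩ := hmem j hj
    obtain ⟨hdvd, hx, hy, hz, hΔ⟩ := hV j hj
    have h := quotient_bounds h1 hR h4 hdvd hx hy hz hΔ
    rw [← hE j] at h
    exact h
  have hNS : ∀ j ∈ S, ∀ A B n : ℤ, (A : ℝ) * Q₁ j + B * Q₂ j = n → ¬(A = 0 ∧ B = 0) →
      (R : ℤ) < 1000 * max |A| |B| := by
    intro j hj A B n hrel hAB
    obtain ⟨h1, h2, -, h4, -⟩ := hmem j hj
    obtain ⟨hq1, hq2, -, -⟩ := hF2 j hj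
    exact no_short_relation h1 h2 hR h4 hq1 hq2 hrel hAB
  -- the code lands in the box
  have hmaps : ∀ j ∈ S, Ψ j ∈ Box := by
    intro j hj
    obtain ⟨-, hx, hy, hz, -⟩ := hV j hj
    obtain ⟨ht1, ht2⟩ := hF1 j hj
    obtain ⟨hq1, hq2, -, -⟩ := hF2 j hj
    obtain ⟨-, -, hE103, -, -⟩ := hF3 j hj
    have c1 : ⌊(Q₁ j - x₀ + 81 / M) * (72000 * M)⌋ ∈ Finset.Icc (0 : ℤ) 11664000 := by
      have hb : |Q₁ j - x₀| ≤ 81 / M := by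
        calc |Q₁ j - x₀| ≤ |Q₁ j - ((j.2 : ℝ) / j.1 - P j)| + |((j.2 : ℝ) / j.1 - P j) - x₀| :=
              abs_sub_le _ _ _
          _ ≤ 80 / M + 1 / M := by rw [abs_sub_comm]; exact add_le_add hq1 ht1
          _ = 81 / M := by ring
      obtain ⟨hb1, hb2⟩ := abs_le.mp hb
      apply floor_mem_Icc
      · push_cast
        exact mul_nonneg (by linarith) (by positivity)
      · push_cast
        have hle : Q₁ j - x₀ + 81 / M ≤ 162 / M := by
          calc Q₁ j - x₀ + 81 / M ≤ 81 / M + 81 / M := by linarith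
            _ = 162 / M := by ring
        calc (Q₁ j - x₀ + 81 / M) * (72000 * M) ≤ (162 / M) * (72000 * M) := by gcongr
          _ = 11664000 := by rw [div_mul_eq_mul_div, div_eq_iff hMne]; ring
          _ < 11664000 + 1 := by norm_num
    have c2 : ⌊(Q₂ j - y₀ + 81 / M) * (72000 * M)⌋ ∈ Finset.Icc (0 : ℤ) 11664000 := by
      have hb : |Q₂ j - y₀| ≤ 81 / M := by
        calc |Q₂ j - y₀| ≤ |Q₂ j - ((j.2 : ℝ) ^ 2 / j.1 - Qr j)| +
              |((j.2 : ℝ) ^ 2 / j.1 - Qr j) - y₀| := abs_sub_le _ _ _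
          _ ≤ 80 / M + 1 / M := by rw [abs_sub_comm]; exact add_le_add hq2 ht2
          _ = 81 / M := by ring
      obtain ⟨hb1, hb2⟩ := abs_le.mp hb
      apply floor_mem_Icc
      · push_cast
        exact mul_nonneg (by linarith) (by positivity)
      · push_cast
        have hle : Q₂ j - y₀ + 81 / M ≤ 162 / M := by
          calc Q₂ j - y₀ + 81 / M ≤ 81 / M + 81 / M := by linarith
            _ = 162 / M := by ring
        calc (Q₂ j - y₀ + 81 / M) * (72000 * M) ≤ (162 / M) * (72000 * M) := by gcongr
          _ = 11664000 := by rw [div_mul_eq_mul_div, div_eq_iff hMne]; ring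
          _ < 11664000 + 1 := by norm_num
    have c3 : ⌊(1000 * X j : ℝ) / R⌋ ∈ Finset.Icc (-2000 : ℤ) 2000 := by
      obtain ⟨l1, l2⟩ := abs_le.mp hx
      have l1' : ((-(2 * R) : ℤ) : ℝ) ≤ X j := by exact_mod_cast l1
      have l2' : (X j : ℝ) ≤ ((2 * R : ℤ) : ℝ) := by exact_mod_cast l2
      push_cast at l1' l2'
      apply floor_mem_Icc
      · rw [le_div_iff₀ hRr]; push_cast; linarith
      · rw [div_lt_iff₀ hRr]; push_cast; linarith
    have c4 : ⌊(1000 * Y j : ℝ) / R⌋ ∈ Finset.Icc (-2000 : ℤ) 2000 := by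
      obtain ⟨l1, l2⟩ := abs_le.mp hy
      have l1' : ((-(2 * R) : ℤ) : ℝ) ≤ Y j := by exact_mod_cast l1
      have l2' : (Y j : ℝ) ≤ ((2 * R : ℤ) : ℝ) := by exact_mod_cast l2
      push_cast at l1' l2'
      apply floor_mem_Icc
      · rw [le_div_iff₀ hRr]; push_cast; linarith
      · rw [div_lt_iff₀ hRr]; push_cast; linarith
    have c5 : ⌊(1000 * Z j : ℝ) / R⌋ ∈ Finset.Icc (-1000 : ℤ) 1000 := by
      obtain ⟨l1, l2⟩ := abs_le.mp hz
      have l1' : ((-R : ℤ) : ℝ) ≤ Z j := by exact_mod_cast l1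
      have l2' : (Z j : ℝ) ≤ ((R : ℤ) : ℝ) := by exact_mod_cast l2
      push_cast at l1' l2'
      apply floor_mem_Icc
      · rw [le_div_iff₀ hRr]; push_cast; linarith
      · rw [div_lt_iff₀ hRr]; push_cast; linarith
    have c6 : E j ∈ Finset.Icc (-103 : ℤ) 103 := Finset.mem_Icc.mpr (abs_le.mp hE103)
    have c7 : ⌊((j.2 : ℝ) / j.1 - P j - x₀ + 1 / M) * (2 * M)⌋ ∈ Finset.Icc (0 : ℤ) 4 := by
      obtain ⟨l1, l2⟩ := abs_le.mp ht1
      apply floor_mem_Icc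
      · push_cast
        exact mul_nonneg (by linarith) (by positivity)
      · push_cast
        have hle : (j.2 : ℝ) / j.1 - P j - x₀ + 1 / M ≤ 2 / M := by
          calc (j.2 : ℝ) / j.1 - P j - x₀ + 1 / M ≤ 1 / M + 1 / M := by linarith
            _ = 2 / M := by ring
        calc ((j.2 : ℝ) / j.1 - P j - x₀ + 1 / M) * (2 * M) ≤ (2 / M) * (2 * M) := by gcongr
          _ = 4 := by rw [div_mul_eq_mul_div, div_eq_iff hMne]; ring
          _ < 4 + 1 := by norm_num
    rw [hΨ j, hBox]
    simp only [Finset.mem_product]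
    exact ⟨c1, c2, c3, c4, c5, c6, c7⟩
  -- the code is injective
  have hinj : Set.InjOn Ψ S := by
    intro j hj k hk hjk
    rw [hΨ j, hΨ k] at hjk
    simp only [Prod.mk.injEq] at hjk
    obtain ⟨hc1, hc2, hfx, hfy, hfz, hEE, hT⟩ := hjk
    -- Step 1: the approximants coincide
    have hd1 : |Q₁ j - Q₁ k| < 1 / (72000 * M) := by
      have h := abs_sub_lt_of_floor_mul_eq (by positivity : (0 : ℝ) < 72000 * M) hc1
      rwa [show Q₁ j - x₀ + 81 / M - (Q₁ k - x₀ + 81 / M) = Q₁ j - Q₁ k by ring] at h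
    have hd2 : |Q₂ j - Q₂ k| < 1 / (72000 * M) := by
      have h := abs_sub_lt_of_floor_mul_eq (by positivity : (0 : ℝ) < 72000 * M) hc2
      rwa [show Q₂ j - y₀ + 81 / M - (Q₂ k - y₀ + 81 / M) = Q₂ j - Q₂ k by ring] at h
    obtain ⟨e1, hE0, -, hΔ0, hΔ6⟩ := hF3 j hj
    obtain ⟨e2, -, -, hΔ0', hΔ6'⟩ := hF3 k hk
    obtain ⟨hQQ1, hQQ2⟩ := dichotomy hR0 hR hMpos hΔ0 hΔ0' hΔ6 hΔ6' (hQ₁ j) (hQ₂ j) (hQ₁ k)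
      (hQ₂ k) (hNS j hj) hd1 hd2
    -- Step 2: the good vectors coincide
    obtain ⟨-, -, hrel1, hrel2⟩ := hF2 j hj
    obtain ⟨-, -, hrel1', hrel2'⟩ := hF2 k hk
    rw [← hQQ1, ← hQQ2] at hrel1' hrel2'
    obtain ⟨hYY, hZZ⟩ := eq_of_rel_of_floor_eq hR0 (hNS j hj) hrel1 hrel1' hfy hfz
    obtain ⟨hXX, -⟩ := eq_of_rel_of_floor_eq hR0 (hNS j hj) hrel2 hrel2' hfx hfy
    -- Step 3: the moduli coincide
    have hmm : j.1 = k.1 := by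
      rw [← hXX, ← hYY, ← hZZ, ← hEE, ← e1] at e2
      exact_mod_cast mul_right_cancel₀ hE0 e2.symm
    -- Step 4: the roots coincide
    have hνν : j.2 = k.2 := by
      obtain ⟨-, hm2, hνm, -, -⟩ := hmem j hj
      obtain ⟨-, -, hνm', -, -⟩ := hmem k hk
      rw [← hmm] at hνm' hT
      exact eq_of_tcode_eq hm2 (by omega) hνm hνm' hT
    exact Sigma.ext hmm (heq_of_eq hνν)
  exact_mod_cast Finset.card_le_card_of_injOn Ψ (fun j hj => hmaps j hj) hinj

end Literature.NumberTheory.Sieve
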